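import Summits.ResolutionOfSingularities.ResolutionOfSingularities.Theorems.FrobeniusClosingPatchingRelPerfectDepthFlagLegalCapstone
import Summits.ResolutionOfSingularities.ResolutionOfSingularities.Theorems.FrobeniusClosingPatchingRelPerfectDepthLegalRestartLoop
import HarnessLib

/-!
# Crux `PatchingRelPerfect` (stmt-ResolutionOfSingularities-16161), chain W5.2 — T6-E1b CAPSTONE §4: the stage-1 legal divisor
# reduction modulo F-72 ALONE

[OURS · L1 W5.2 · rung tool · res-L1-w52-plan-1 NAMING G10-9 (b) «§4 as an APPEND-only sibling `…DepthFlagLegalCapstoneF72` once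
res-type-049's R6 `…DepthLegalRestartLoop` is in the tree»] res-type-003 g8.  The capstone `…DepthFlagLegalCapstone` (res-L1-w52-idea-1,
p540279) gives `LegalScopedDivisorReduction₃` modulo ONE OURS binder `SingCentres₃` and ONE named fact F-72
(`legalScopedDivisorReduction₃_of_singCentres₃_of_F72`); res-type-049's freeze-and-restart loop R1–R6 discharges that last binder from the
SAME fact: `LegalRestart.singCentres₃_of_canonicalSequence_history : F-72 → SingCentres₃` (`…DepthLegalRestartLoop`).  Composing:

the SCOPED reduction modulo F-72 ALONE is res-type-049's `LegalRestart.legalScopedDivisorReduction₃_of_canonicalSequence_history`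
(rev 2 of `…DepthLegalRestartLoop`, first pid governs — CITED here, not restated); this sibling adds the two statements not yet in the
tree:

* `legalDivisorReduction₃_of_F72` — the UNSCOPED twin `LegalDivisorReduction₃` modulo ⟨F-72, F-32bR⟩;
* **`stageOneFlag₃_of_F72`** — T6-E1 `StageOneFlag₃` modulo ⟨[CoP1] Prop. 4.4 (F-33∃, CONDITIONAL binder), F-32bR, F-72⟩ and NO OURS
  binder (res-L1-w52-idea-1 O6 / res-type-049 15:00:06Z: «keep only the genuinely new»).

Every theorem is CONDITIONAL on the named facts shown in its signature and on nothing else; one-line compositions of tree theorems; nothing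
here is a statement of the manuscript under review (AI-written, weaker than expert review).  HONEST CAVEAT (slot W5.2): the crux
`PatchingRelPerfect` also carries the patching problem (known in dimension ≤ 3 only); this is a rung of the LOCAL core.

## References
* V. Cossart, U. Jannsen, S. Saito, *Desingularization: invariants and strategy*, LNM 2270 (2020), Thm. 1.4, Cor. 6.26, Def. 6.23. [CossartJannsenSaito2020]
* V. Cossart, O. Piltant, *Resolution of singularities of threefolds in positive characteristic I*, J. Algebra 320 (2008), Prop. 4.4. [CossartPiltant2008]
* J. Kollár, *Lectures on Resolution of Singularities* (2007), (3.111) Step 3. [Kollar2007]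
-/

-- `Summit.<Summit>.<Sub>.Theorems` with `Sub = Summit` (single-conjunct summit, D-0017)
set_option linter.dupNamespace false

noncomputable section

open CategoryTheory AlgebraicGeometry TopologicalSpace
open Literature.AlgebraicGeometry.Resolution

namespace Summit.ResolutionOfSingularities.ResolutionOfSingularities.Theorems.DepthTargets

universe u

/-! ## §4 The last OURS binder discharged (res-type-049): the unscoped twin and T6-E1 modulo named facts only -/

/-- [OURS · L1 W5.2] The UNSCOPED twin `LegalDivisorReduction₃` modulo ⟨F-72, F-32bR⟩ (capstone §1 `legalDivisorReduction₃_of_binders` with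
both binders discharged from F-72: `LegalRestart.singCentres₃_of_canonicalSequence_history`, `DepthLegal.oldBoundaryResolution₃_of_F72`). PROVED (CONDITIONAL on F-72 and F-32bR). [cite: CossartJannsenSaito2020, Thm. 1.4, Cor. 6.26] -/
theorem legalDivisorReduction₃_of_F72 (hCJS : CossartJannsenSaito2020EmbeddedSequenceB.{u})
    (h72 : CossartJannsenSaito2020_canonicalSequence_history.{u}) : LegalDivisorReduction₃.{u} :=
  legalDivisorReduction₃_of_binders hCJS (LegalRestart.singCentres₃_of_canonicalSequence_history h72)
    (DepthLegal.oldBoundaryResolution₃_of_F72 h72)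

/-- [OURS · L1 W5.2] **T6-E1 `StageOneFlag₃` modulo ⟨[CoP1] Prop. 4.4 (F-33∃, CONDITIONAL binder — never a premise of the chain),
F-32bR, F-72⟩ and NO OURS binder** (capstone §3 `stageOneFlag₃_of_singCentres₃_of_F72` ∘ res-type-049's `LegalRestart.singCentres₃_of_canonicalSequence_history`). PROVED (CONDITIONAL on
the three named facts). [cite: CossartPiltant2008, Prop. 4.4] [cite: CossartJannsenSaito2020, Thm. 1.4, Cor. 6.26] -/
theorem stageOneFlag₃_of_F72 (h44 : CossartPiltant2008_prop44.{u}) (hCJS : CossartJannsenSaito2020EmbeddedSequenceB.{u})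
    (h72 : CossartJannsenSaito2020_canonicalSequence_history.{u}) : StageOneFlag₃.{u} :=
  stageOneFlag₃_of_singCentres₃_of_F72 h44 hCJS (LegalRestart.singCentres₃_of_canonicalSequence_history h72) h72

end Summit.ResolutionOfSingularities.ResolutionOfSingularities.Theorems.DepthTargets

end
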